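import Literature.Geometry.Lorentzian.AsymptoticallyFlatChart
import HarnessLib

/-!
# Restricting an asymptotically flat end to a far region; decay depends only on far sections

Plumbing for gluing constructions with asymptotically flat initial data (topic
`Geometry/Lorentzian`; everything PROVED, the only definitions are the explicit restricted end
and its chart). For an end `e : AFEnd X` (`AsymptoticFlatness.lean`: open `U ⊆ X`, radius `R`,
diffeomorphism `chart : U ≅ {R < ‖x‖}`, closed at infinity) and a radius `R₁ ≥ R`:

* `AFEnd.farOpens e R₁` — the far region `e.far R₁` as an open submanifold of `X`;
* `AFEnd.restrict e hR₁ : AFEnd X` — **the same end seen from radius `R₁`**: open set `far R₁`,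
  radius `R₁`, chart the restriction of `e.chart` (explicitly: `q ↦ e.coord q`, inverse
  `z ↦ e.dataChart z`); `restrict_dataChart`, `restrict_far_of_le`, `coord_restrict`:
  its inverse chart, far regions (beyond `R₁`) and coordinate function are those of `e`;
* `hCoeff_restrict`, `kCoeff_restrict` — its chart components agree with those of `e` beyond
  radius `R₁`; hence `isStronglyAsymptoticallyFlatWith_restrict_iff` (every decay class is
  unchanged) and `isSoleEnd_restrict_iff`;
* `IsStronglyAsymptoticallyFlatWith.congr_of_eqOn_far` — **decay only sees the far sections**:
  two data sets whose metric and second-fundamental-form sections agree on some far region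
  `e.far R₀` lie in the same decay classes on `e` (the chart components agree on `{R₀ < ‖x‖}`,
  a neighbourhood of infinity, so all `iteratedFDeriv`s agree there);
* `IsSoleEnd.isCompact_compl_far` — for a sole end EVERY far region has compact complement
  (from `exists_isCompact_compl_far_subset`), and `IsSoleEnd.exists_far_subset_compl` — the far
  regions of a sole end eventually avoid any given compact set.

These are the bookkeeping facts behind "modify admissible data inside a compact set / beyond a
large sphere and keep the same structure at infinity" (Bartnik, CPAM 39 (1986), §1: the sets
`E_R` and the structure of infinity `Φ` restricted to them; Corvino–Schoen-type gluing keeps the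
chart of the end). No decay estimate is proved here.

## References

* R. Bartnik, *The mass of an asymptotically flat manifold*, CPAM 39 (1986), §1. [Bartnik1986]
* M. Dafermos, I. Rodnianski, *Lectures on black holes and linear waves*, Clay Math. Proc. 17
  (2013), App. B.2.3 (the decay class). [DafermosRodnianski2013]
-/

noncomputable section

open Bundle Set Filter Metric Asymptotics Bornology TopologicalSpace
open scoped Manifold ContDiff Topology

namespace Literature.Geometry.Lorentzian

namespace AFEnd

variable {X : Type} [TopologicalSpace X] [ChartedSpace E3 X]
  (e : AFEnd X)

/-! ### The far region as an open submanifold; the restricted chart -/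

/-- The far region `e.far R₁ = chart⁻¹ {R₁ < ‖x‖}` as an open subset of `X` (Bartnik's `E_{R₁}`).
[cite: Bartnik1986, §1] -/
def farOpens (R₁ : ℝ) : Opens X := ⟨e.far R₁, e.isOpen_far R₁⟩

/-- Membership in `farOpens` is membership in `far`. [folklore] -/
@[simp] theorem mem_farOpens {R₁ : ℝ} {q : X} : q ∈ e.farOpens R₁ ↔ q ∈ e.far R₁ := Iff.rfl

/-- The underlying set of `farOpens R₁` is `far R₁`. [folklore] -/
@[simp] theorem coe_farOpens (R₁ : ℝ) : ((e.farOpens R₁ : Opens X) : Set X) = e.far R₁ := rfl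

variable {R₁ : ℝ}

/-- A point of `far R₁` lies in the end (local copy of the lemma of `EndCompactification.lean`,
which is not imported here to keep the gluing tower out of this file). [cite: Bartnik1986, §1] -/
private theorem memU_of_far {q : X} (hq : q ∈ e.far R₁) : q ∈ e.U := e.far_subset R₁ hq

/-- A point of `far R₁` has coordinate norm `> R₁` (local copy, see above). [cite: Bartnik1986, §1] -/
private theorem lt_coord_of_far {q : X} (hq : q ∈ e.far R₁) : R₁ < ‖e.coord q‖ := by
  obtain ⟨_, h⟩ := e.mem_far_iff_coord.1 hq
  exact h

/-- A point of the end with coordinate norm `> R₁` lies in `far R₁` (local copy, see above).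
[cite: Bartnik1986, §1] -/
private theorem far_of_lt_coord {q : X} (hq : q ∈ e.U) (h : R₁ < ‖e.coord q‖) : q ∈ e.far R₁ :=
  e.mem_far_iff_coord.2 ⟨hq, h⟩

/-- `dataChart z ∈ far R₁` iff `R₁ < ‖z‖`. [cite: Bartnik1986, §1] -/
theorem dataChart_mem_far_iff {z : exteriorRegion e.R} : e.dataChart z ∈ e.far R₁ ↔ R₁ < ‖(z : E3)‖ := by
  rw [e.mem_far_iff_coord, e.coord_dataChart]
  exact ⟨fun ⟨_, h⟩ ↦ h, fun h ↦ ⟨(e.chart.symm z).2, h⟩⟩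

section Restrict

/-- The forward restricted chart `q ↦ coord q : far R₁ → {R₁ < ‖x‖}` is smooth (it is `coord`,
smooth on the end, read between open submanifolds). [folklore] -/
theorem contMDiff_restrictChart_toFun :
    ContMDiff (𝓡 3) (𝓡 3) ∞ (fun q : e.farOpens R₁ ↦
      (⟨e.coord q, e.lt_coord_of_far (e.mem_farOpens.1 q.2)⟩ : exteriorRegion R₁)) := by
  rw [← ContMDiff.subtypeVal_comp_iff]
  intro q
  exact (contMDiffAt_subtype_iff (U := e.farOpens R₁) (f := e.coord)).2
    (e.contMDiffAt_coord (e.memU_of_far (e.mem_farOpens.1 q.2)))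

variable (hR₁ : e.R ≤ R₁)
include hR₁

/-- The backward restricted chart `z ↦ dataChart z : {R₁ < ‖x‖} → far R₁` is smooth (it is
`dataChartExt`, smooth on the exterior region). [folklore] -/
theorem contMDiff_restrictChart_invFun :
    ContMDiff (𝓡 3) (𝓡 3) ∞ (fun z : exteriorRegion R₁ ↦
      (⟨e.dataChart ⟨z, lt_of_le_of_lt hR₁ z.2⟩, e.dataChart_mem_far_iff.2 z.2⟩ : e.farOpens R₁)) := by
  rw [← ContMDiff.subtypeVal_comp_iff]
  have h : (Subtype.val ∘ fun z : exteriorRegion R₁ ↦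
      (⟨e.dataChart ⟨z, lt_of_le_of_lt hR₁ z.2⟩, e.dataChart_mem_far_iff.2 z.2⟩ : e.farOpens R₁)) =
      fun z : exteriorRegion R₁ ↦ e.dataChartExt (z : E3) := by
    funext z
    simp only [Function.comp_apply, e.dataChartExt_of_lt (lt_of_le_of_lt hR₁ z.2)]
  rw [h]
  intro z
  exact (contMDiffAt_subtype_iff (U := exteriorRegion R₁) (f := e.dataChartExt)).2
    (e.contMDiffAt_dataChartExt (lt_of_le_of_lt hR₁ z.2))

/-- **The restricted chart** `far R₁ ≅ {R₁ < ‖x‖}`: `q ↦ coord q` with inverse `z ↦ dataChart z`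
(the restriction of `e.chart`, written through the total coordinate function `AFEnd.coord` and
the inverse chart). [cite: Bartnik1986, §1] -/
def restrictChart : Diffeomorph (𝓡 3) (𝓡 3) (e.farOpens R₁) (exteriorRegion R₁) ∞ where
  toFun q := ⟨e.coord q, e.lt_coord_of_far (e.mem_farOpens.1 q.2)⟩
  invFun z := ⟨e.dataChart ⟨z, lt_of_le_of_lt hR₁ z.2⟩, e.dataChart_mem_far_iff.2 z.2⟩
  left_inv q := Subtype.ext (e.dataChart_coord (e.memU_of_far (e.mem_farOpens.1 q.2)))
  right_inv _ := Subtype.ext (e.coord_dataChart _)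
  contMDiff_toFun := e.contMDiff_restrictChart_toFun
  contMDiff_invFun := e.contMDiff_restrictChart_invFun hR₁

/-- The restricted chart is `coord`. [folklore] -/
@[simp] theorem coe_restrictChart (q : e.farOpens R₁) :
    ((e.restrictChart hR₁ q : exteriorRegion R₁) : E3) = e.coord q := rfl

/-- The inverse of the restricted chart is `dataChart`. [folklore] -/
@[simp] theorem coe_restrictChart_symm (z : exteriorRegion R₁) :
    (((e.restrictChart hR₁).symm z : e.farOpens R₁) : X) = e.dataChart ⟨z, lt_of_le_of_lt hR₁ z.2⟩ :=
  rfl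

/-- **The end restricted to the far region `far R₁`** (`R₁ ≥ R`): open set `far R₁`, radius `R₁`,
chart the restriction of `e.chart`. It is closed at infinity because its closed far sets
`{R'' ≤ ‖coord‖}`, `R'' > R₁`, are exactly those of `e`. Bartnik 1986, §1 (the structure of
infinity restricted to `E_{R₁}`). [cite: Bartnik1986, §1] -/
def restrict : AFEnd X where
  U := e.farOpens R₁
  R := R₁
  R_pos := e.R_pos.trans_le hR₁
  chart := e.restrictChart hR₁
  isClosed_far R'' hR'' := by
    have heq : ((↑) : e.farOpens R₁ → X) '' (e.restrictChart hR₁ ⁻¹' {x | R'' ≤ ‖(x : E3)‖}) =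
        ((↑) : e.U → X) '' (e.chart ⁻¹' {x | R'' ≤ ‖(x : E3)‖}) := by
      apply subset_antisymm
      · rintro _ ⟨q, hq, rfl⟩
        refine ⟨⟨q, e.memU_of_far q.2⟩, ?_, rfl⟩
        show R'' ≤ ‖(e.chart ⟨q, e.memU_of_far q.2⟩ : E3)‖
        rw [← e.coord_of_mem]
        exact hq
      · rintro _ ⟨q, hq, rfl⟩
        have hq' : R'' ≤ ‖e.coord q‖ := by
          rw [e.coord_of_mem q.2]
          exact hq
        exact ⟨⟨q, e.far_of_lt_coord q.2 (lt_of_lt_of_le hR'' hq')⟩, hq', rfl⟩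
    rw [heq]
    exact e.isClosed_far R'' (lt_of_le_of_lt hR₁ hR'')

/-- The radius of the restricted end is `R₁`. [folklore] -/
@[simp] theorem restrict_R : (e.restrict hR₁).R = R₁ := rfl

/-- The open set of the restricted end is `far R₁`. [folklore] -/
@[simp] theorem coe_restrict_U : ((e.restrict hR₁).U : Set X) = e.far R₁ := rfl

/-- Membership in the open set of the restricted end. [folklore] -/
theorem mem_restrict_U {q : X} : q ∈ (e.restrict hR₁).U ↔ q ∈ e.far R₁ := Iff.rfl

/-- **The inverse chart of the restricted end is that of `e`.** [cite: Bartnik1986, §1] -/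
theorem restrict_dataChart (z : exteriorRegion R₁) :
    (e.restrict hR₁).dataChart z = e.dataChart ⟨z, lt_of_le_of_lt hR₁ z.2⟩ := rfl

/-- The total inverse chart of the restricted end agrees with that of `e` beyond `R₁`. [folklore] -/
theorem restrict_dataChartExt {z : E3} (hz : R₁ < ‖z‖) :
    (e.restrict hR₁).dataChartExt z = e.dataChartExt z := by
  rw [(e.restrict hR₁).dataChartExt_of_lt hz, e.dataChartExt_of_lt (lt_of_le_of_lt hR₁ hz)]
  rfl

/-- **The coordinate function of the restricted end is that of `e` on `far R₁`.** [folklore] -/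
theorem coord_restrict {q : X} (hq : q ∈ e.far R₁) : (e.restrict hR₁).coord q = e.coord q := by
  rw [(e.restrict hR₁).coord_of_mem ((e.mem_restrict_U hR₁).2 hq)]
  rfl

/-- **The far regions of the restricted end beyond `R₁` are those of `e`.** [cite: Bartnik1986, §1] -/
theorem restrict_far_of_le {R'' : ℝ} (h : R₁ ≤ R'') : (e.restrict hR₁).far R'' = e.far R'' := by
  ext q
  rw [(e.restrict hR₁).mem_far_iff_coord, e.mem_far_iff_coord]
  constructor
  · rintro ⟨hq, hlt⟩
    have hq' : q ∈ e.far R₁ := (e.mem_restrict_U hR₁).1 hq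
    rw [e.coord_restrict hR₁ hq'] at hlt
    exact ⟨e.memU_of_far hq', hlt⟩
  · rintro ⟨hq, hlt⟩
    have hq' : q ∈ e.far R₁ := e.far_of_lt_coord hq (lt_of_le_of_lt h hlt)
    refine ⟨(e.mem_restrict_U hR₁).2 hq', ?_⟩
    rwa [e.coord_restrict hR₁ hq']

/-- In general the far regions of the restricted end are `far (max R₁ R'')`. [cite: Bartnik1986, §1] -/
theorem restrict_far (R'' : ℝ) : (e.restrict hR₁).far R'' = e.far (max R₁ R'') := by
  ext q
  rw [(e.restrict hR₁).mem_far_iff_coord, e.mem_far_iff_coord]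
  constructor
  · rintro ⟨hq, hlt⟩
    have hq' : q ∈ e.far R₁ := (e.mem_restrict_U hR₁).1 hq
    rw [e.coord_restrict hR₁ hq'] at hlt
    exact ⟨e.memU_of_far hq', max_lt (e.lt_coord_of_far hq') hlt⟩
  · rintro ⟨hq, hlt⟩
    have hq' : q ∈ e.far R₁ := e.far_of_lt_coord hq ((le_max_left _ _).trans_lt hlt)
    refine ⟨(e.mem_restrict_U hR₁).2 hq', ?_⟩
    rw [e.coord_restrict hR₁ hq']
    exact (le_max_right _ _).trans_lt hlt

/-- **The restricted end is a sole end iff `e` is.** [cite: SchoenYau1979] -/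
theorem isSoleEnd_restrict_iff : (e.restrict hR₁).IsSoleEnd ↔ e.IsSoleEnd := by
  constructor
  · rintro ⟨R', hR', hK⟩
    refine ⟨R', lt_of_le_of_lt hR₁ hR', ?_⟩
    rwa [e.restrict_far_of_le hR₁ (le_of_lt hR')] at hK
  · rintro ⟨R', hR', hK⟩
    obtain ⟨K, hK', hsub⟩ := exists_isCompact_compl_far_subset ⟨R', hR', hK⟩ (R₁ + 1)
    refine ⟨R₁ + 1, by simp, ?_⟩
    rw [e.restrict_far_of_le hR₁ (by linarith)]
    exact hK'.of_isClosed_subset (e.isOpen_far _).isClosed_compl hsub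

end Restrict

section Coeff

variable [IsManifold (𝓡 3) ∞ X] (D : InitialDataSet (𝓡 3) X)

/-- On the exterior region the chart components of `k` are the pullback of `k` along the inverse
chart (the `dif` of `AFEnd.kCoeff` resolved at a point of the subtype).
[cite: ChristodoulouKlainerman1993, (1.0.9)] -/
theorem kCoeff_coe (z : exteriorRegion e.R) :
    kCoeff e D (z : E3) = pullbackBilin (I := 𝓡 3) (I' := 𝓡 3) e.dataChart D.k z := by
  have h : e.R < ‖(z : E3)‖ := z.2
  unfold kCoeff
  rw [dif_pos h]

/-- The chart components of `h`, as a bilinear form, evaluate the metric on chart directions: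
`h_ij(z) vⁱ wʲ = h(dΦ v, dΦ w)`, `Φ = dataChart`. [cite: Bartnik1986, (1.3)] -/
theorem hCoeff_apply_eq_dataChart (z : exteriorRegion e.R) (v w : E3) :
    hCoeff e D (z : E3) v w = D.h.inner (e.dataChart z) (mfderiv (𝓡 3) (𝓡 3) e.dataChart z v)
      (mfderiv (𝓡 3) (𝓡 3) e.dataChart z w) := by
  rw [e.hCoeff_coe D z]
  rfl

/-- The chart components of `k`, as a bilinear form, evaluate `k` on chart directions.
[cite: ChristodoulouKlainerman1993, (1.0.9)] -/
theorem kCoeff_apply_eq_dataChart (z : exteriorRegion e.R) (v w : E3) :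
    kCoeff e D (z : E3) v w = D.k (e.dataChart z) (mfderiv (𝓡 3) (𝓡 3) e.dataChart z v)
      (mfderiv (𝓡 3) (𝓡 3) e.dataChart z w) := by
  rw [e.kCoeff_coe D z]
  rfl

/-- The chart components of `h` evaluate the metric on chart directions read through the total
inverse chart `dataChartExt`. [cite: Bartnik1986, (1.3)] -/
theorem hCoeff_apply_eq_dataChartExt {z : E3} (hz : e.R < ‖z‖) (v w : E3) :
    hCoeff e D z v w = D.h.inner (e.dataChartExt z) (mfderiv 𝓘(ℝ, E3) (𝓡 3) e.dataChartExt z v)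
      (mfderiv 𝓘(ℝ, E3) (𝓡 3) e.dataChartExt z w) := by
  have h := e.hCoeff_apply_eq_dataChart D ⟨z, hz⟩ v w
  rw [e.mfderiv_dataChart_eq, e.mfderiv_dataChart_eq] at h
  rw [e.dataChartExt_of_lt hz]
  exact h

/-- The chart components of `k` evaluate `k` on chart directions read through the total inverse
chart. [cite: ChristodoulouKlainerman1993, (1.0.9)] -/
theorem kCoeff_apply_eq_dataChartExt {z : E3} (hz : e.R < ‖z‖) (v w : E3) :
    kCoeff e D z v w = D.k (e.dataChartExt z) (mfderiv 𝓘(ℝ, E3) (𝓡 3) e.dataChartExt z v)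
      (mfderiv 𝓘(ℝ, E3) (𝓡 3) e.dataChartExt z w) := by
  have h := e.kCoeff_apply_eq_dataChart D ⟨z, hz⟩ v w
  rw [e.mfderiv_dataChart_eq, e.mfderiv_dataChart_eq] at h
  rw [e.dataChartExt_of_lt hz]
  exact h

/-- **The chart components of `h` for the restricted end are those of `e` beyond `R₁`** (both read
the metric through the same inverse chart). [cite: Bartnik1986, (1.3)] -/
theorem hCoeff_restrict (hR₁ : e.R ≤ R₁) {z : E3} (hz : R₁ < ‖z‖) : hCoeff (e.restrict hR₁) D z = hCoeff e D z := by
  have hz' : e.R < ‖z‖ := lt_of_le_of_lt hR₁ hz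
  have hev : (e.restrict hR₁).dataChartExt =ᶠ[𝓝 z] e.dataChartExt := by
    filter_upwards [(isOpen_lt continuous_const continuous_norm).mem_nhds hz] with y hy
    exact e.restrict_dataChartExt hR₁ hy
  ext v w
  rw [(e.restrict hR₁).hCoeff_apply_eq_dataChartExt D (by exact hz), e.hCoeff_apply_eq_dataChartExt D hz',
    hev.mfderiv_eq, e.restrict_dataChartExt hR₁ hz]

/-- **The chart components of `k` for the restricted end are those of `e` beyond `R₁`.**
[cite: ChristodoulouKlainerman1993, (1.0.9)] -/
theorem kCoeff_restrict (hR₁ : e.R ≤ R₁) {z : E3} (hz : R₁ < ‖z‖) : kCoeff (e.restrict hR₁) D z = kCoeff e D z := by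
  have hz' : e.R < ‖z‖ := lt_of_le_of_lt hR₁ hz
  have hev : (e.restrict hR₁).dataChartExt =ᶠ[𝓝 z] e.dataChartExt := by
    filter_upwards [(isOpen_lt continuous_const continuous_norm).mem_nhds hz] with y hy
    exact e.restrict_dataChartExt hR₁ hy
  ext v w
  rw [(e.restrict hR₁).kCoeff_apply_eq_dataChartExt D (by exact hz), e.kCoeff_apply_eq_dataChartExt D hz',
    hev.mfderiv_eq, e.restrict_dataChartExt hR₁ hz]

end Coeff

end AFEnd

/-! ### Decay depends only on the chart components near infinity -/

namespace AFEnd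

section Congr

variable {X : Type} [TopologicalSpace X] [ChartedSpace E3 X] [IsManifold (𝓡 3) ∞ X]

/-- **Decay classes see only the chart components near infinity.** If the chart components of
`(e, D)` and `(e', D')` agree beyond some radius `R₀` then `IsStronglyAsymptoticallyFlatWith`
transfers from one to the other (the differences with `(1 + 2M/r) δ` and all their
`iteratedFDeriv`s agree on the open set `{R₀ < ‖x‖}`, a member of `cobounded E3`).
[cite: DafermosRodnianski2013, App. B.2.3] -/
theorem IsStronglyAsymptoticallyFlatWith.of_eqOn_coeff {e e' : AFEnd X}
    {D D' : InitialDataSet (𝓡 3) X} {M β γ : ℝ} {nh nk : ℕ} {R₀ : ℝ}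
    (hh : ∀ x : E3, R₀ < ‖x‖ → AFEnd.hCoeff e' D' x = AFEnd.hCoeff e D x)
    (hk : ∀ x : E3, R₀ < ‖x‖ → AFEnd.kCoeff e' D' x = AFEnd.kCoeff e D x)
    (h : e.IsStronglyAsymptoticallyFlatWith D M β γ nh nk) :
    e'.IsStronglyAsymptoticallyFlatWith D' M β γ nh nk := by
  have hopen : IsOpen {x : E3 | R₀ < ‖x‖} := isOpen_lt continuous_const continuous_norm
  have hmem : {x : E3 | R₀ < ‖x‖} ∈ cobounded E3 := by
    filter_upwards [eventually_cobounded_le_norm (E := E3) (R₀ + 1)] with x hx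
    exact lt_of_lt_of_le (lt_add_one R₀) hx
  refine ⟨fun m hm ↦ ?_, fun m hm ↦ ?_⟩
  · refine (h.1 m hm).congr' ?_ EventuallyEq.rfl
    filter_upwards [hmem] with x hx
    have hev : (fun y ↦ AFEnd.hCoeff e D y - (1 + 2 * M / ‖y‖) • (innerSL ℝ : E3 →L[ℝ] E3 →L[ℝ] ℝ)) =ᶠ[𝓝 x]
        fun y ↦ AFEnd.hCoeff e' D' y - (1 + 2 * M / ‖y‖) • (innerSL ℝ : E3 →L[ℝ] E3 →L[ℝ] ℝ) := by
      filter_upwards [hopen.mem_nhds hx] with y hy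
      rw [hh y hy]
    rw [(hev.iteratedFDeriv ℝ m).eq_of_nhds]
  · refine (h.2 m hm).congr' ?_ EventuallyEq.rfl
    filter_upwards [hmem] with x hx
    have hev : AFEnd.kCoeff e D =ᶠ[𝓝 x] AFEnd.kCoeff e' D' := by
      filter_upwards [hopen.mem_nhds hx] with y hy
      rw [hk y hy]
    rw [(hev.iteratedFDeriv ℝ m).eq_of_nhds]

/-- **Data with the same sections on a far region have the same decay on that end.** If the
metrics and the tensors `k` of `D`, `D'` agree at every point of `e.far R₀` then every decay class
`IsStronglyAsymptoticallyFlatWith e · M β γ nh nk` transfers from `D` to `D'` (the chart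
components are pullbacks along the inverse chart, which lands in `far R₀` beyond radius `R₀`).
Bartnik 1986, §1; Dafermos–Rodnianski 2013, App. B.2.3. [cite: DafermosRodnianski2013, App. B.2.3] -/
theorem IsStronglyAsymptoticallyFlatWith.congr_of_eqOn_far {e : AFEnd X}
    {D D' : InitialDataSet (𝓡 3) X} {M β γ : ℝ} {nh nk : ℕ} {R₀ : ℝ}
    (hh : ∀ q ∈ e.far R₀, D'.h.inner q = D.h.inner q) (hk : ∀ q ∈ e.far R₀, D'.k q = D.k q)
    (h : e.IsStronglyAsymptoticallyFlatWith D M β γ nh nk) :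
    e.IsStronglyAsymptoticallyFlatWith D' M β γ nh nk := by
  refine h.of_eqOn_coeff (R₀ := max R₀ e.R) (fun x hx ↦ ?_) (fun x hx ↦ ?_)
  · have hxR : e.R < ‖x‖ := (le_max_right _ _).trans_lt hx
    have hfar : e.dataChartExt x ∈ e.far R₀ := by
      rw [e.dataChartExt_of_lt hxR, e.dataChart_mem_far_iff]
      exact (le_max_left _ _).trans_lt hx
    ext v w
    rw [e.hCoeff_apply_eq_dataChartExt D' hxR, e.hCoeff_apply_eq_dataChartExt D hxR, hh _ hfar]
  · have hxR : e.R < ‖x‖ := (le_max_right _ _).trans_lt hx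
    have hfar : e.dataChartExt x ∈ e.far R₀ := by
      rw [e.dataChartExt_of_lt hxR, e.dataChart_mem_far_iff]
      exact (le_max_left _ _).trans_lt hx
    ext v w
    rw [e.kCoeff_apply_eq_dataChartExt D' hxR, e.kCoeff_apply_eq_dataChartExt D hxR, hk _ hfar]

/-- Data with the same far sections have the same Dafermos–Rodnianski decay.
[cite: DafermosRodnianski2013, App. B.2.3] -/
theorem IsStronglyAsymptoticallyFlatDR.congr_of_eqOn_far {e : AFEnd X}
    {D D' : InitialDataSet (𝓡 3) X} {M R₀ : ℝ}
    (hh : ∀ q ∈ e.far R₀, D'.h.inner q = D.h.inner q) (hk : ∀ q ∈ e.far R₀, D'.k q = D.k q)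
    (h : e.IsStronglyAsymptoticallyFlatDR D M) : e.IsStronglyAsymptoticallyFlatDR D' M :=
  IsStronglyAsymptoticallyFlatWith.congr_of_eqOn_far hh hk h

/-- **Every decay class is unchanged by restricting the end.** [cite: DafermosRodnianski2013, App. B.2.3] -/
theorem isStronglyAsymptoticallyFlatWith_restrict_iff (e : AFEnd X) {R₁ : ℝ} (hR₁ : e.R ≤ R₁)
    (D : InitialDataSet (𝓡 3) X) (M β γ : ℝ) (nh nk : ℕ) :
    (e.restrict hR₁).IsStronglyAsymptoticallyFlatWith D M β γ nh nk ↔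
      e.IsStronglyAsymptoticallyFlatWith D M β γ nh nk :=
  ⟨fun h ↦ h.of_eqOn_coeff (R₀ := R₁) (fun _ hx ↦ (e.hCoeff_restrict D hR₁ hx).symm)
      (fun _ hx ↦ (e.kCoeff_restrict D hR₁ hx).symm),
    fun h ↦ h.of_eqOn_coeff (R₀ := R₁) (fun _ hx ↦ e.hCoeff_restrict D hR₁ hx)
      (fun _ hx ↦ e.kCoeff_restrict D hR₁ hx)⟩

/-- Dafermos–Rodnianski decay is unchanged by restricting the end. [cite: DafermosRodnianski2013, App. B.2.3] -/
theorem isStronglyAsymptoticallyFlatDR_restrict_iff (e : AFEnd X) {R₁ : ℝ} (hR₁ : e.R ≤ R₁)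
    (D : InitialDataSet (𝓡 3) X) (M : ℝ) :
    (e.restrict hR₁).IsStronglyAsymptoticallyFlatDR D M ↔ e.IsStronglyAsymptoticallyFlatDR D M :=
  e.isStronglyAsymptoticallyFlatWith_restrict_iff hR₁ D M 1 2 2 1

end Congr

/-! ### Sole ends: every far region has compact complement; far regions avoid compacts -/

section Sole

variable {X : Type} [TopologicalSpace X] [ChartedSpace E3 X]

/-- **For a sole end every far region has compact complement** (its complement is closed and
contained in the compact set of `exists_isCompact_compl_far_subset`). Schoen–Yau 1979, §1
(`N ∖ K` a union of ends). [cite: SchoenYau1979] -/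
theorem IsSoleEnd.isCompact_compl_far {e : AFEnd X} (h : e.IsSoleEnd) (R₂ : ℝ) :
    IsCompact (e.far R₂)ᶜ := by
  obtain ⟨K, hK, hsub⟩ := exists_isCompact_compl_far_subset h R₂
  exact hK.of_isClosed_subset (e.isOpen_far R₂).isClosed_compl hsub

/-- **Every point has a neighbourhood missing all far regions beyond some radius**: if `q` lies
in the end take the points of coordinate norm `< ‖coord q‖ + 1`, otherwise the complement of the
closed far set `chart⁻¹ {R + 1 ≤ ‖x‖}` (`AFEnd.isClosed_far`). Bartnik 1986, §1 (the exhaustion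
by the sets `E_R`). [cite: Bartnik1986, §1] -/
theorem exists_nhds_forall_disjoint_far (e : AFEnd X) (q : X) :
    ∃ V ∈ 𝓝 q, ∃ R₀ : ℝ, ∀ R, R₀ ≤ R → Disjoint (e.far R) V := by
  by_cases hq : q ∈ e.U
  · -- inside the end: bound the coordinate norm
    have hcont : ContinuousAt e.coord q := (e.contMDiffAt_coord hq).continuousAt
    have hV : {p : X | ‖e.coord p‖ < ‖e.coord q‖ + 1} ∈ 𝓝 q :=
      hcont.preimage_mem_nhds ((isOpen_lt continuous_norm continuous_const).mem_nhds (by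
        show ‖e.coord q‖ < ‖e.coord q‖ + 1
        linarith))
    refine ⟨_, hV, ‖e.coord q‖ + 1, fun R hR ↦ Set.disjoint_left.2 fun p hp hpV ↦ ?_⟩
    have h1 : R < ‖e.coord p‖ := e.lt_coord_of_far hp
    have h2 : ‖e.coord p‖ < ‖e.coord q‖ + 1 := hpV
    linarith
  · -- outside the end: the complement of a closed far set
    set C : Set X := ((↑) : e.U → X) '' (e.chart ⁻¹' {x | e.R + 1 ≤ ‖(x : E3)‖}) with hC
    have hCcl : IsClosed C := e.isClosed_far (e.R + 1) (by linarith)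
    have hqC : q ∉ C := by
      rintro ⟨q', -, rfl⟩
      exact hq q'.2
    refine ⟨Cᶜ, hCcl.isOpen_compl.mem_nhds hqC, e.R + 1, fun R hR ↦
      Set.disjoint_left.2 fun p hp hpC ↦ hpC ?_⟩
    obtain ⟨p', hp', rfl⟩ := hp
    exact ⟨p', le_trans hR (le_of_lt hp'), rfl⟩

/-- **Far regions eventually avoid compact sets**: for a compact `K ⊆ X` there is `R₀` with
`e.far R ∩ K = ∅` for all `R ≥ R₀` (compactness and `exists_nhds_forall_disjoint_far`). No decay
and no sole-end hypothesis is needed. [cite: Bartnik1986, §1] -/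
theorem exists_forall_far_disjoint (e : AFEnd X) {K : Set X} (hK : IsCompact K) :
    ∃ R₀ : ℝ, ∀ R, R₀ ≤ R → Disjoint (e.far R) K := by
  refine hK.induction_on (p := fun s ↦ ∃ R₀ : ℝ, ∀ R, R₀ ≤ R → Disjoint (e.far R) s)
    ⟨0, fun R _ ↦ disjoint_empty _⟩ ?_ ?_ ?_
  · rintro s t hst ⟨R₀, h⟩
    exact ⟨R₀, fun R hR ↦ (h R hR).mono_right hst⟩
  · rintro s t ⟨R₀, hs⟩ ⟨R₁, ht⟩
    exact ⟨max R₀ R₁, fun R hR ↦ (hs R ((le_max_left _ _).trans hR)).union_right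
      (ht R ((le_max_right _ _).trans hR))⟩
  · intro q _
    obtain ⟨V, hV, R₀, h⟩ := e.exists_nhds_forall_disjoint_far q
    exact ⟨V, mem_nhdsWithin_of_mem_nhds hV, R₀, h⟩

/-- **For a sole end of `X`, far regions eventually avoid any compact set and have compact
complement**: given a compact `K` there is `R₀ > R` such that for all `R' ≥ R₀`, `far R'` misses `K`
and `(far R')ᶜ` is compact. [cite: SchoenYau1979] -/
theorem IsSoleEnd.exists_far_disjoint_isCompact_compl {e : AFEnd X} (h : e.IsSoleEnd)
    {K : Set X} (hK : IsCompact K) :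
    ∃ R₀ : ℝ, e.R < R₀ ∧ ∀ R', R₀ ≤ R' → Disjoint (e.far R') K ∧ IsCompact (e.far R')ᶜ := by
  obtain ⟨R₀, hR₀⟩ := e.exists_forall_far_disjoint hK
  exact ⟨max R₀ (e.R + 1), lt_of_lt_of_le (by linarith) (le_max_right _ _),
    fun R' hR' ↦ ⟨hR₀ R' ((le_max_left _ _).trans hR'), h.isCompact_compl_far R'⟩⟩

end Sole

end AFEnd

end Literature.Geometry.Lorentzian

end
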